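import Mathlib
import Summits.NavierStokesRegularity.NavierStokesRegularity.Theses.FrozenSignCascade
import Summits.NavierStokesRegularity.NavierStokesRegularity.Theses.TypeILiouville
import Summits.NavierStokesRegularity.NavierStokesRegularity.Theorems.FrozenSignCascadeEnvelopeBoundNoBlowup
import Summits.NavierStokesRegularity.NavierStokesRegularity.Theorems.FrozenSignCascadeBoundedEnvelopeContinuationOfLiouville
import Summits.NavierStokesRegularity.NavierStokesRegularity.Theorems.TautLoopKelvinTautCompressionIntegrableSummitEquivalence
import Summits.NavierStokesRegularity.NavierStokesRegularity.Theorems.TypeILiouvilleLKillsTypeI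
import HarnessLib

/-!
# Route FrozenSignCascade · crux `EnvelopeBound` (stmt-NavierStokesRegularity-1549) is
  SUMMIT-EQUIVALENT modulo its sibling leaf — the kernel-checked certificate, BY ITEM NAME

Support file for the crux item stmt-NavierStokesRegularity-1549 (`EnvelopeBound`, leaf (A) of route
`FrozenSignCascade`); lands `--supports` that item (line `registered`, lead c6, HONEST re-audit).
No statement of any route is asserted: every theorem is an implication between NAMED items of the
ledger, composed from files already accepted in the tree.

**The position of leaf (A) in the programme's partial order, exactly.**

* `envelopeBound_of_navierStokesRegularity` — **the summit implies (A)**: Clay (A)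
  (`NavierStokesRegularity`) ⇒ no blow-up in the classical Leray–Hopf class
  (`TypeILiouville.TypeIliouvilleThesis` = stmt-0054, by the landed
  `TautCompressionIntegrable.SummitEquivalence.typeILiouvilleThesis_of_navierStokesRegularity`: blow-up
  assembly + proved Clay-class uniqueness) ⇒ `T_max = ∞` for every Clay datum ⇒ (A)
  (`EnvelopeBound.Kato.envelopeBound_of_typeIliouvilleThesis`, lead c5). Hence (A) is a NECESSARY
  condition for the Millennium statement: by contraposition any refutation of (A) refutes Clay (A)
  itself (the route's kill criterion (i) can only fire together with the summit).
* `boundedEnvelopeContinuation_of_navierStokesRegularity` — the summit implies leaf (B) outright (B's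
  conclusion is the summit's conclusion for that datum; the envelope hypothesis is idle).
* `navierStokesRegularity_iff_envelopeBound_and_boundedEnvelopeContinuation` — therefore the route's
  thesis X = (A) ∧ (B) is **equivalent** to the summit (`FrozenSignCascade.closes` is the converse).
* `envelopeBound_iff_navierStokesRegularity`, `envelopeBound_iff_typeIliouvilleThesis` — **given (B),
  (A) ⇔ summit ⇔ stmt-0054**; and since (B) is landed under the Liouville conjecture (L)
  (`BoundedEnvelope.boundedEnvelopeContinuation_of_typeIliouvilleL`, B-lead), the same equivalences
  hold **given (L) = `TypeILiouville.TypeIliouvilleL`** (stmt-10661):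
  `envelopeBound_iff_navierStokesRegularity_of_typeIliouvilleL`,
  `envelopeBound_iff_typeIliouvilleThesis_of_typeIliouvilleL`.
* `envelopeBound_iff_forall_katoMaximalTime_eq_top` — given (B), (A) ⇔ "every Clay datum has
  infinite Kato maximal time" (the converse of c5's `envelopeBound_of_katoMaximalTime_eq_top`).
* DOMINATION: `frozenSignCascade_hypotheses_of_typeILiouville_cruxes` — the two OPEN cruxes of route
  TypeILiouville (`TypeIliouvilleNoTypeII` = stmt-0056 and `TypeIliouvilleL` = stmt-10661; its support
  `TypeIliouvilleLKillsTypeI` is proved, `typeILiouville_typeIliouvilleLKillsTypeI_proof`) imply BOTH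
  hypotheses of `FrozenSignCascade.closes`.

Consequence for the crux chain of stmt-1549 (recorded in `Cruxes/EnvelopeBound/Lines/*` and
`PICKED.md`): (A) is not an intermediate milestone — modulo (B) (or (L)) it IS the summit, and
unconditionally it is implied by the summit; every line for (A) must therefore prove no blow-up for
all Clay data (or exhibit the route's signed-cascade mechanism as a genuinely new regularity proof).
The item is parked on stmt-0054 (`blocked-on`), exactly as for `TautCompressionIntegrable`
(stmt-15248, `TautLoopKelvinTautCompressionIntegrableSummitEquivalence.lean`, whose pattern this file
follows).

References: C. Fefferman, Clay problem description (2000), (A); P. G. Lemarié-Rieusset (2016),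
Thm. 15.1 (C); G. Koch, N. Nadirashvili, G. Seregin, V. Šverák, Acta Math. 203 (2009), §1 (L).
-/

noncomputable section

set_option linter.dupNamespace false -- nested layout Summit.<S>.<Sub>, Sub = S (D-0017)

namespace Summit.NavierStokesRegularity.NavierStokesRegularity.Theorems.EnvelopeBound.SummitEquivalence

open Summit.NavierStokesRegularity.NavierStokesRegularity
open Literature.Analysis.FluidPDE

/-! ### The summit implies both leaves -/

/-- **Clay (A) implies the crux (A) = `EnvelopeBound`.** The summit excludes blow-up in the classical
Leray–Hopf class (`typeILiouvilleThesis_of_navierStokesRegularity`, stmt-0054 from the summit), and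
no blow-up gives the envelope bound (`EnvelopeBound.Kato.envelopeBound_of_typeIliouvilleThesis`).
So `EnvelopeBound` is a necessary condition for `NavierStokesRegularity`. [folklore] -/
theorem envelopeBound_of_navierStokesRegularity (hNS : _root_.NavierStokesRegularity) :
    Theses.FrozenSignCascade.EnvelopeBound :=
  EnvelopeBound.Kato.envelopeBound_of_typeIliouvilleThesis
    (TautCompressionIntegrable.SummitEquivalence.typeILiouvilleThesis_of_navierStokesRegularity hNS)

/-- **Clay (A) implies the crux (B) = `BoundedEnvelopeContinuation` outright**: the conclusion of (B)
for a datum is the summit's conclusion for that datum; the envelope hypothesis is not used. [folklore] -/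
theorem boundedEnvelopeContinuation_of_navierStokesRegularity (hNS : _root_.NavierStokesRegularity) :
    Theses.FrozenSignCascade.BoundedEnvelopeContinuation :=
  fun ν hν u₀ hu hd hdiv _ => hNS ν hν u₀ hu hdiv hd

/-! ### The route's thesis is summit-equivalent -/

/-- **`NavierStokesRegularity ↔ EnvelopeBound ∧ BoundedEnvelopeContinuation`**: the thesis
X = (A) ∧ (B) of route `FrozenSignCascade` is equivalent to the summit (`→` by the two previous
theorems, `←` is the route's deciding theorem `FrozenSignCascade.closes`). [folklore] -/
theorem navierStokesRegularity_iff_envelopeBound_and_boundedEnvelopeContinuation :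
    _root_.NavierStokesRegularity ↔
      Theses.FrozenSignCascade.EnvelopeBound ∧ Theses.FrozenSignCascade.BoundedEnvelopeContinuation :=
  ⟨fun hNS => ⟨envelopeBound_of_navierStokesRegularity hNS,
      boundedEnvelopeContinuation_of_navierStokesRegularity hNS⟩,
    fun h => Theses.FrozenSignCascade.closes h.1 h.2⟩

/-! ### Leaf (A) modulo leaf (B) -/

/-- **Given (B), the crux (A) is equivalent to the summit.** [folklore] -/
theorem envelopeBound_iff_navierStokesRegularity
    (hB : Theses.FrozenSignCascade.BoundedEnvelopeContinuation) :
    Theses.FrozenSignCascade.EnvelopeBound ↔ _root_.NavierStokesRegularity :=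
  ⟨fun hA => Theses.FrozenSignCascade.closes hA hB, envelopeBound_of_navierStokesRegularity⟩

/-- **Given (B), the crux (A) is equivalent to the no-blow-up item stmt-NavierStokesRegularity-0054**
(`TypeILiouville.TypeIliouvilleThesis`). [folklore] -/
theorem envelopeBound_iff_typeIliouvilleThesis
    (hB : Theses.FrozenSignCascade.BoundedEnvelopeContinuation) :
    Theses.FrozenSignCascade.EnvelopeBound ↔ Theses.TypeILiouville.TypeIliouvilleThesis :=
  ⟨fun hA => TautCompressionIntegrable.SummitEquivalence.typeILiouvilleThesis_of_navierStokesRegularity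
      (Theses.FrozenSignCascade.closes hA hB),
    EnvelopeBound.Kato.envelopeBound_of_typeIliouvilleThesis⟩

/-- **Given (B), the crux (A) is equivalent to "every Clay datum has infinite Kato maximal time"**
(`→`: summit ⇒ stmt-0054 ⇒ `EnvelopeBound.Kato.katoMaximalTime_eq_top_of_noBlowup`; `←` is c5's
`EnvelopeBound.Kato.envelopeBound_of_katoMaximalTime_eq_top`, which does not need (B)).
[cite: LemarieRieusset2016, Thm. 15.1 (C) with Thm. 7.2] -/
theorem envelopeBound_iff_forall_katoMaximalTime_eq_top
    (hB : Theses.FrozenSignCascade.BoundedEnvelopeContinuation) :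
    Theses.FrozenSignCascade.EnvelopeBound ↔
      ∀ ν : ℝ, 0 < ν → ∀ u₀ : EuclideanSpace ℝ (Fin 3) → EuclideanSpace ℝ (Fin 3),
        ContDiff ℝ (⊤ : ℕ∞) u₀ → NSWave0.IsDivFree u₀ → HasRapidSpatialDecay u₀ →
        katoMaximalTime ν u₀ = ⊤ :=
  ⟨fun hA _ hν _ hu hdiv hd => EnvelopeBound.Kato.katoMaximalTime_eq_top_of_noBlowup
      ((envelopeBound_iff_typeIliouvilleThesis hB).1 hA) hν hu hdiv hd,
    EnvelopeBound.Kato.envelopeBound_of_katoMaximalTime_eq_top⟩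

/-! ### Leaf (A) modulo the Liouville conjecture (L) -/

/-- **Given the KNSS Liouville conjecture (L) = item `TypeILiouville.TypeIliouvilleL`
(stmt-NavierStokesRegularity-10661), the crux (A) is equivalent to the summit**: (L) ⇒ (B) is the
landed `BoundedEnvelope.boundedEnvelopeContinuation_of_typeIliouvilleL`.
[cite: KochNadirashviliSereginSverak2009, §1 conjecture (L) (arXiv:0709.3599)] -/
theorem envelopeBound_iff_navierStokesRegularity_of_typeIliouvilleL
    (hL : Theses.TypeILiouville.TypeIliouvilleL) :
    Theses.FrozenSignCascade.EnvelopeBound ↔ _root_.NavierStokesRegularity :=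
  envelopeBound_iff_navierStokesRegularity (BoundedEnvelope.boundedEnvelopeContinuation_of_typeIliouvilleL hL)

/-- **Given (L), the crux (A) is equivalent to the no-blow-up item stmt-0054.**
[cite: KochNadirashviliSereginSverak2009, §1 conjecture (L) (arXiv:0709.3599)] -/
theorem envelopeBound_iff_typeIliouvilleThesis_of_typeIliouvilleL
    (hL : Theses.TypeILiouville.TypeIliouvilleL) :
    Theses.FrozenSignCascade.EnvelopeBound ↔ Theses.TypeILiouville.TypeIliouvilleThesis :=
  envelopeBound_iff_typeIliouvilleThesis (BoundedEnvelope.boundedEnvelopeContinuation_of_typeIliouvilleL hL)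

/-! ### Domination by route TypeILiouville -/

/-- **No Type II ∧ (L) ⇒ no blow-up** (the internal step of `TypeILiouville.closes`, concluded at the
route's target stmt-0054 instead of the summit): a non-extending solution is maximal, has the Type-I
rate by `TypeIliouvilleNoTypeII`, and cannot have it by the PROVED support
`typeILiouville_typeIliouvilleLKillsTypeI_proof` fed with (L).
[cite: KochNadirashviliSereginSverak2009, §1 and §6 Prop. 6.1 (arXiv:0709.3599)] -/
theorem typeIliouvilleThesis_of_noTypeII_of_typeIliouvilleL
    (hII : Theses.TypeILiouville.TypeIliouvilleNoTypeII) (hL : Theses.TypeILiouville.TypeIliouvilleL) :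
    Theses.TypeILiouville.TypeIliouvilleThesis := by
  intro ν T hν hT u p hcl hLH hdec
  by_contra hext
  have hmax : IsMaximalSmoothSolution ν 0 u p T := ⟨hcl, hext⟩
  exact Theorems.typeILiouville_typeIliouvilleLKillsTypeI_proof hL ν T hν hT u p hmax hLH hdec
    (hII ν T hν hT u p hmax hLH hdec)

/-- **DOMINATION CERTIFICATE.** The two open cruxes of route TypeILiouville — `TypeIliouvilleNoTypeII`
(stmt-0056) and `TypeIliouvilleL` (stmt-10661) — imply BOTH hypotheses `EnvelopeBound` (stmt-1549) and
`BoundedEnvelopeContinuation` (stmt-10579) of `FrozenSignCascade.closes`.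
[cite: KochNadirashviliSereginSverak2009, §1 and §6 Prop. 6.1 (arXiv:0709.3599)] -/
theorem frozenSignCascade_hypotheses_of_typeILiouville_cruxes
    (hII : Theses.TypeILiouville.TypeIliouvilleNoTypeII) (hL : Theses.TypeILiouville.TypeIliouvilleL) :
    Theses.FrozenSignCascade.EnvelopeBound ∧ Theses.FrozenSignCascade.BoundedEnvelopeContinuation :=
  ⟨EnvelopeBound.Kato.envelopeBound_of_typeIliouvilleThesis
      (typeIliouvilleThesis_of_noTypeII_of_typeIliouvilleL hII hL),
    BoundedEnvelope.boundedEnvelopeContinuation_of_typeIliouvilleL hL⟩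

/-! ### Registered form -/

/-- **Registered tools stub `stub_summitEquivalence` of the crux stmt-NavierStokesRegularity-1549**
(line `registered`, lead c6): the calibration of this file as one conjunction — summit ⇒ (A);
summit ⇔ (A) ∧ (B); (B) ⇒ ((A) ⇔ summit); (L) ⇒ ((A) ⇔ stmt-0054); stmt-0056 ∧ stmt-10661 ⇒ (A) ∧ (B).
[folklore] -/
theorem stub_summitEquivalence :
    (NavierStokesRegularity →
      Summit.NavierStokesRegularity.NavierStokesRegularity.Theses.FrozenSignCascade.EnvelopeBound) ∧
    (NavierStokesRegularity ↔
      Summit.NavierStokesRegularity.NavierStokesRegularity.Theses.FrozenSignCascade.EnvelopeBound ∧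
      Summit.NavierStokesRegularity.NavierStokesRegularity.Theses.FrozenSignCascade.BoundedEnvelopeContinuation) ∧
    (Summit.NavierStokesRegularity.NavierStokesRegularity.Theses.FrozenSignCascade.BoundedEnvelopeContinuation →
      (Summit.NavierStokesRegularity.NavierStokesRegularity.Theses.FrozenSignCascade.EnvelopeBound ↔
        NavierStokesRegularity)) ∧
    (Summit.NavierStokesRegularity.NavierStokesRegularity.Theses.TypeILiouville.TypeIliouvilleL →
      (Summit.NavierStokesRegularity.NavierStokesRegularity.Theses.FrozenSignCascade.EnvelopeBound ↔
        Summit.NavierStokesRegularity.NavierStokesRegularity.Theses.TypeILiouville.TypeIliouvilleThesis)) ∧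
    (Summit.NavierStokesRegularity.NavierStokesRegularity.Theses.TypeILiouville.TypeIliouvilleNoTypeII →
      Summit.NavierStokesRegularity.NavierStokesRegularity.Theses.TypeILiouville.TypeIliouvilleL →
      Summit.NavierStokesRegularity.NavierStokesRegularity.Theses.FrozenSignCascade.EnvelopeBound ∧
      Summit.NavierStokesRegularity.NavierStokesRegularity.Theses.FrozenSignCascade.BoundedEnvelopeContinuation) :=
  ⟨envelopeBound_of_navierStokesRegularity,
    navierStokesRegularity_iff_envelopeBound_and_boundedEnvelopeContinuation,
    envelopeBound_iff_navierStokesRegularity,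
    envelopeBound_iff_typeIliouvilleThesis_of_typeIliouvilleL,
    frozenSignCascade_hypotheses_of_typeILiouville_cruxes⟩

end Summit.NavierStokesRegularity.NavierStokesRegularity.Theorems.EnvelopeBound.SummitEquivalence

end
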